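import Mathlib
import Summits.Ventures.PercRepro2.Defs
import Summits.Ventures.PercRepro2.Graph
import Summits.Ventures.PercRepro2.OneColourSwitch
import Summits.Ventures.PercRepro2.RegionHubSign
import Summits.Ventures.PercRepro2.SideSwitch
import Summits.Ventures.PercRepro2.SideSwitchFibre
import Summits.Ventures.PercRepro2.SideSwitchClosed
import Summits.Ventures.PercRepro2.SideSwitchComps
import Summits.Ventures.PercRepro2.SideSwitchCompsFibre
import Summits.Ventures.PercRepro2.TermSwitchDefs
import Summits.Ventures.PercRepro2.TermSwitchM9
import Summits.Ventures.PercRepro2.M9NoPocketDefs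
import Summits.Ventures.PercRepro2.M9NoPocketWorld
import Summits.Ventures.PercRepro2.M9NoPocketWorldD
import Summits.Ventures.PercRepro2.M9NoPocketCompl
import Summits.Ventures.PercRepro2.M9DAvoid
import Summits.Ventures.PercRepro2.M9DAvoidSplit
import Summits.Ventures.PercRepro2.M9RegionSplit
import Summits.Ventures.PercRepro2.M9HarrisCube
import Summits.Ventures.PercRepro2.M9PocketCubeDefs
import Summits.Ventures.PercRepro2.M9PocketCubeFibre
import Summits.Ventures.PercRepro2.M9PocketCubeMono
import Summits.Ventures.PercRepro2.M9PocketCubeHub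
import Summits.Ventures.PercRepro2.M9PocketCubeWorldMono
import Summits.Ventures.PercRepro2.M9PocketCubeCompl
import Summits.Ventures.PercRepro2.M9PocketCubeHarrisY
import Summits.Ventures.PercRepro2.M9SingleDPocket
import Summits.Ventures.PercRepro2.M9DeadEnd
import Summits.Ventures.PercRepro2.M9DeadEndMono

/-!
# The block-dead-end part of the A-region is non-positive: Harris on the block-group cube
(blind cell PercRepro2, p3 g23, 2026-08-28; `proofs/P3-HARRIS.md` §10)

On the cube of a pocket representative the **A1-region** `regA1` — legal vectors with `d ∉ M₂`,
no `Y`-hub, a `W`-hub or a block dead end, and `r ≁_W s` in `G − d` — is a **down-set**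
(`regA1_lower`), so the tilt lemma of `M9HarrisCube` gives `Σ_{regA1} σ̃_pq ≤ 0`
(`regA1_sum_nonpos`) and the fibration sums it to `regionA1 ≤ 0` (`regionA1_nonpos`).  Together
with the dead-end partition of `M9DeadEnd` this reduces the general single-`d` statement with
`d` on both terminals to the **pocket residual** `regionP` (the A-points with a pocket vertex
doubly connected to `d` and no block dead end): `dSignSum ≤ 0` on every graph with edges `d–r`,
`d–s` as soon as `regionP ≤ 0` (`dSignSum_nonpos_of_regionP_nonpos`).  Own work; std axioms.
-/

namespace Summit.Ventures.PercRepro2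

namespace NoPocket

open Finset Classical RegionHub OneColourSwitch SideSwitch TermSwitch

variable {V : Type*} {E : Type*}

section SepTransfer

variable {ends : E → Sym2 V}

/-- **`Sep` from `Sep` in `G − d`, `d ∉ M₂` and no `Y`-hub edge** (the mirror of
`sep2_of_not_mem_K2_of_not_hubW`). -/
lemma sep2_of_not_mem_M2_of_not_hubY {p q r s d : V} (hpd : p ≠ d) (hqd : q ≠ d) {ω : Config E}
    (hsep : sep2 (endsD ends d) p q r s ω) (hM : d ∉ M2 ends r s ω)
    (hY : ¬ hubY ends d p q ω) : sep2 ends p q r s ω := by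
  have h := sep2_of_not_mem_K2_of_not_hubW (ω := OneColourSwitch.compl ω) hpd hqd
    (sep2_compl.2 hsep) (by rwa [K2_compl]) (by rwa [hubW_compl])
  exact sep2_compl.1 h

end SepTransfer

section Region

variable [Fintype V] [DecidableEq V] [Fintype E] [DecidableEq E]

variable (ends : E → Sym2 V)

/-- The A1-region of a representative: legal vectors with `d ∉ M₂`, no `Y`-hub, a `W`-hub or a
block dead end, and `r ≁_W s` in `G − d`. -/
noncomputable def regA1 (p q r s d : V) (ρ : Config E) : Finset (Finset (Finset V) × Finset E) :=
  (cubeP ends d r s ρ).filter (fun x => assignX ends x ρ ∈ DOneSet ends p q r s d ∧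
    d ∉ M2 ends r s (assignX ends x ρ) ∧ ¬ hubY ends d p q (assignX ends x ρ) ∧
    (hubW ends d p q (assignX ends x ρ) ∨ deadWb ends d r s (assignX ends x ρ)) ∧
    ¬ Conn (endsD ends d) (OneColourSwitch.compl (assignX ends x ρ)) r s)

/-- The A1-region sum: `Σ_{Sep ∧ DOne ∧ d ∉ M₂ ∧ ¬hubY ∧ (hubW ∨ deadWb) ∧ r ≁_W s in G−d} σ̃_pq`. -/
noncomputable def regionA1 (p q r s d : V) : ℤ :=
  ∑ ω : Config E, if sep2 ends p q r s ω ∧ DOne ends r s d ω ∧ d ∉ M2 ends r s ω ∧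
      ¬ hubY ends d p q ω ∧ (hubW ends d p q ω ∨ deadWb ends d r s ω) ∧
      ¬ Conn (endsD ends d) (OneColourSwitch.compl ω) r s then
    sigma (endsD ends d) ω p q else 0

/-- The pocket residual: the A-region points with neither a `W`-hub nor a block dead end. -/
noncomputable def regionP (p q r s d : V) : ℤ :=
  ∑ ω : Config E, if sep2 ends p q r s ω ∧ DOne ends r s d ω ∧ regA ends p q r s d ω ∧
      ¬ (hubW ends d p q ω ∨ deadWb ends d r s ω) ∧
      ¬ Conn (endsD ends d) (OneColourSwitch.compl ω) r s then
    sigma (endsD ends d) ω p q else 0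

variable {ends}

/-- Membership in the A1-region. -/
lemma mem_regA1 {p q r s d : V} {ρ : Config E} {x : Finset (Finset V) × Finset E} :
    x ∈ regA1 ends p q r s d ρ ↔ x ∈ cubeP ends d r s ρ ∧
      (assignX ends x ρ ∈ DOneSet ends p q r s d ∧ d ∉ M2 ends r s (assignX ends x ρ) ∧
        ¬ hubY ends d p q (assignX ends x ρ) ∧
        (hubW ends d p q (assignX ends x ρ) ∨ deadWb ends d r s (assignX ends x ρ)) ∧
        ¬ Conn (endsD ends d) (OneColourSwitch.compl (assignX ends x ρ)) r s) := by
  simp [regA1]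

/-- **The A1-region is a down-set of the cube.** -/
theorem regA1_lower {p q r s d : V} (hr : d ≠ r) (hs : d ≠ s) (hpd : p ≠ d) (hqd : q ≠ d)
    {er : E} (her : ends er = s(d, r)) {ρ : Config E} (hρ : ρ ∈ RepP ends p q r s d)
    {x x' : Finset (Finset V) × Finset E} (hxx' : x' ≤ x) (hx' : x' ∈ cubeP ends d r s ρ)
    (hx : x ∈ regA1 ends p q r s d ρ) : x' ∈ regA1 ends p q r s d ρ := by
  obtain ⟨hρD, _⟩ := mem_RepP.1 hρ
  obtain ⟨hxc, hxD, hM, hY, hWD, hrs⟩ := mem_regA1.1 hx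
  obtain ⟨_, hD⟩ := mem_DOneSet.1 hxD
  obtain ⟨hT', hF'⟩ := mem_cubeP.1 hx'
  have hM' : d ∉ M2 ends r s (assignX ends x' ρ) :=
    fun h' => hM (mem_M2_assignX_mono hr hs hρ hxx' hx' hxc h')
  have hY' : ¬ hubY ends d p q (assignX ends x' ρ) :=
    fun h' => hY (hubY_assignX_mono hr hs hpd hqd hρ hxx' hx' hxc h')
  have hWD' : hubW ends d p q (assignX ends x' ρ) ∨ deadWb ends d r s (assignX ends x' ρ) := by
    rcases hWD with hW | hDW
    · exact Or.inl (hubW_assignX_anti hr hs hpd hqd hρ hxx' hx' hxc hW)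
    · exact Or.inr (deadWb_assignX_anti hr hs hρ hxx' hxc hx' hM hDW)
  have hrs' : ¬ Conn (endsD ends d) (OneColourSwitch.compl (assignX ends x' ρ)) r s :=
    fun h' => hrs (conn_endsD_compl_assignX_mono_of_mem_M2 hr hs hρD hxx' hx' hxc
      (r_mem_M2 _ _ _) h')
  have hsep' : sep2 ends p q r s (assignX ends x' ρ) :=
    sep2_of_not_mem_M2_of_not_hubY hpd hqd (sep2_endsD_assignX' hr hs hρD hT' hF') hM' hY'
  have hD' : DOne ends r s d (assignX ends x' ρ) :=
    DOne_assignX_anti_of_not_mem_M2 hr hs hρ hxx' hxc hx' her hM hD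
  exact mem_regA1.2 ⟨hx', mem_DOneSet.2 ⟨hsep', hD'⟩, hM', hY', hWD', hrs'⟩

/-- **Harris for the A1-region**: `Σ_{regA1} σ̃_pq ≤ 0` for every pocket representative. -/
theorem regA1_sum_nonpos {p q r s d : V} (hr : d ≠ r) (hs : d ≠ s) (hpd : p ≠ d) (hqd : q ≠ d)
    {er : E} (her : ends er = s(d, r)) {ρ : Config E} (hρ : ρ ∈ RepP ends p q r s d) :
    ∑ x ∈ regA1 ends p q r s d ρ, sigma (endsD ends d) (assignX ends x ρ) p q ≤ 0 := by
  obtain ⟨hρD, _⟩ := mem_RepP.1 hρ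
  set c : Finset (Finset V) × Finset E := (blocks ends d r s ρ, freeE ends d r s ρ) with hc
  have hcube : HarrisCube.cube c = cubeP ends d r s ρ := cube_eq_cubeP ρ
  have hle : ∀ x, x ≤ c ↔ x ∈ cubeP ends d r s ρ := fun x => by
    rw [← HarrisCube.mem_cube, hcube]
  have hκc : ∀ x, x ≤ c → cdualP ends d r s ρ x ≤ c := fun x _ => (hle _).2 (cdualP_mem_cubeP ρ x)
  have hκκ : ∀ x, x ≤ c → cdualP ends d r s ρ (cdualP ends d r s ρ x) = x :=
    fun x hx => cdualP_cdualP ((hle x).1 hx)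
  -- the tilt lemma with `h = 1 − 1[regA1]` (monotone, the region being a down-set)
  have key := HarrisCube.sum_sub_comp_mul_nonneg c (κ := cdualP ends d r s ρ) hκc hκκ
    (fun x _ y _ hxy => cdualP_antitone ρ hxy) (f := yInd ends p q d ρ)
    (h := fun x => 1 - (if x ∈ regA1 ends p q r s d ρ then 1 else 0))
    (fun x _ => yInd_nonneg ρ x) (fun x _ => by split_ifs <;> norm_num) ?_ ?_
  · rw [hcube] at key
    -- Σ (f − f∘κ) = 0
    have hzero : ∑ x ∈ cubeP ends d r s ρ,
        (yInd ends p q d ρ x - yInd ends p q d ρ (cdualP ends d r s ρ x)) = 0 := by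
      rw [Finset.sum_sub_distrib, ← hcube, HarrisCube.sum_comp_involution c hκc hκκ, sub_self]
    have hsub : regA1 ends p q r s d ρ ⊆ cubeP ends d r s ρ := Finset.filter_subset _ _
    have hsplit : ∑ x ∈ cubeP ends d r s ρ,
        (yInd ends p q d ρ x - yInd ends p q d ρ (cdualP ends d r s ρ x)) *
          (1 - (if x ∈ regA1 ends p q r s d ρ then 1 else 0)) =
        ∑ x ∈ cubeP ends d r s ρ,
          (yInd ends p q d ρ x - yInd ends p q d ρ (cdualP ends d r s ρ x)) -
        ∑ x ∈ regA1 ends p q r s d ρ,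
          (yInd ends p q d ρ x - yInd ends p q d ρ (cdualP ends d r s ρ x)) := by
      rw [show (∑ x ∈ cubeP ends d r s ρ,
          (yInd ends p q d ρ x - yInd ends p q d ρ (cdualP ends d r s ρ x)) *
            (1 - (if x ∈ regA1 ends p q r s d ρ then 1 else 0))) =
          ∑ x ∈ cubeP ends d r s ρ,
            ((yInd ends p q d ρ x - yInd ends p q d ρ (cdualP ends d r s ρ x)) -
              (if x ∈ regA1 ends p q r s d ρ then
                yInd ends p q d ρ x - yInd ends p q d ρ (cdualP ends d r s ρ x) else 0)) from
        Finset.sum_congr rfl fun x _ => by split_ifs <;> ring]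
      rw [Finset.sum_sub_distrib, Finset.sum_ite_mem, Finset.inter_eq_right.2 hsub]
    rw [hsplit, hzero, zero_sub, neg_nonneg] at key
    refine le_of_eq_of_le ?_ key
    refine Finset.sum_congr rfl fun x hx => ?_
    exact sigma_endsD_eq_sub_cdualP hr hs hρD (Finset.mem_filter.1 hx).1
  · intro x hx y hy hxy
    have hx' := (hle x).1 hx
    have hy' := (hle y).1 hy
    obtain ⟨hT, hF⟩ := mem_cubeP.1 hx'
    simp only [yInd]
    by_cases h1 : Conn (endsD ends d) (assignX ends x ρ) p q
    · have h2 : Conn (endsD ends d) (assignX ends y ρ) p q :=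
        conn_endsD_assignX_mono hr hs hρ hxy hx' hy'
          (not_mem_K2_of_sep2 (sep2_endsD_assignX' hr hs hρD hT hF)).1 h1
      simp [h1, h2]
    · simp only [h1, if_false]
      split_ifs <;> norm_num
  · intro x hx y hy hxy
    dsimp only
    by_cases h2 : y ∈ regA1 ends p q r s d ρ
    · have h1 : x ∈ regA1 ends p q r s d ρ := regA1_lower hr hs hpd hqd her hρ hxy ((hle x).1 hx) h2
      simp [h1, h2]
    · simp only [h2, if_false]
      split_ifs <;> norm_num

/-- **`regionA1 ≤ 0`** with edges `d–r` and `d–s`. -/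
theorem regionA1_nonpos {p q r s d : V} (hr : d ≠ r) (hs : d ≠ s) (hpd : p ≠ d) (hqd : q ≠ d)
    {er : E} (her : ends er = s(d, r)) : regionA1 ends p q r s d ≤ 0 := by
  have h1 : regionA1 ends p q r s d = ∑ ω ∈ DOneSet ends p q r s d,
      (if d ∉ M2 ends r s ω ∧ ¬ hubY ends d p q ω ∧ (hubW ends d p q ω ∨ deadWb ends d r s ω) ∧
          ¬ Conn (endsD ends d) (OneColourSwitch.compl ω) r s then
        sigma (endsD ends d) ω p q else 0) := by
    unfold regionA1 DOneSet
    rw [Finset.sum_filter]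
    refine Finset.sum_congr rfl fun ω _ => ?_
    by_cases h : sep2 ends p q r s ω ∧ DOne ends r s d ω
    · simp [h]
    · simp only [h, if_false]
      have : ¬ (sep2 ends p q r s ω ∧ DOne ends r s d ω ∧ d ∉ M2 ends r s ω ∧
          ¬ hubY ends d p q ω ∧ (hubW ends d p q ω ∨ deadWb ends d r s ω) ∧
          ¬ Conn (endsD ends d) (OneColourSwitch.compl ω) r s) := fun h' => h ⟨h'.1, h'.2.1⟩
      simp [this]
  rw [h1, sum_dOne_eq_sum_repP_legalP hr hs]
  refine Finset.sum_nonpos fun ρ hρ => ?_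
  have h2 : ∑ x ∈ LegalP ends p q r s d ρ,
      (if d ∉ M2 ends r s (assignX ends x ρ) ∧ ¬ hubY ends d p q (assignX ends x ρ) ∧
          (hubW ends d p q (assignX ends x ρ) ∨ deadWb ends d r s (assignX ends x ρ)) ∧
          ¬ Conn (endsD ends d) (OneColourSwitch.compl (assignX ends x ρ)) r s then
        sigma (endsD ends d) (assignX ends x ρ) p q else 0) =
      ∑ x ∈ regA1 ends p q r s d ρ, sigma (endsD ends d) (assignX ends x ρ) p q := by
    rw [← Finset.sum_filter]
    refine Finset.sum_congr ?_ fun _ _ => rfl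
    ext x
    simp only [Finset.mem_filter, mem_LegalP, mem_regA1]
    tauto
  rw [h2]
  exact regA1_sum_nonpos hr hs hpd hqd her hρ

/-- **`regionA = regionA1 + regionP`.** -/
theorem regionA_eq_add (p q r s d : V) :
    regionA ends p q r s d = regionA1 ends p q r s d + regionP ends p q r s d := by
  unfold regionA regionA1 regionP
  rw [← Finset.sum_add_distrib]
  refine Finset.sum_congr rfl fun ω _ => ?_
  by_cases h : sep2 ends p q r s ω ∧ DOne ends r s d ω ∧ regA ends p q r s d ω ∧
      ¬ Conn (endsD ends d) (OneColourSwitch.compl ω) r s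
  · obtain ⟨hsep, hD, hA, hrs⟩ := h
    obtain ⟨hM, hY, hWD⟩ := hA
    have hA : regA ends p q r s d ω := ⟨hM, hY, hWD⟩
    by_cases hB : hubW ends d p q ω ∨ deadWb ends d r s ω
    · simp [hsep, hD, hM, hY, hrs, hB, hA]
    · simp [hsep, hD, hM, hY, hrs, hB, hA]
  · have h1 : ¬ (sep2 ends p q r s ω ∧ DOne ends r s d ω ∧ d ∉ M2 ends r s ω ∧
        ¬ hubY ends d p q ω ∧ (hubW ends d p q ω ∨ deadWb ends d r s ω) ∧
        ¬ Conn (endsD ends d) (OneColourSwitch.compl ω) r s) := by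
      rintro ⟨hsep, hD, hM, hY, hWD, hrs⟩
      refine h ⟨hsep, hD, ⟨hM, hY, ?_⟩, hrs⟩
      rcases hWD with hW | hDW
      · exact Or.inl hW
      · exact Or.inr (deadW_of_deadWb (by
          rintro rfl; exact hM (r_mem_M2 _ _ _)) (by
          rintro rfl; exact hM (s_mem_M2 _ _ _)) hDW)
    have h2 : ¬ (sep2 ends p q r s ω ∧ DOne ends r s d ω ∧ regA ends p q r s d ω ∧
        ¬ (hubW ends d p q ω ∨ deadWb ends d r s ω) ∧
        ¬ Conn (endsD ends d) (OneColourSwitch.compl ω) r s) :=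
      fun h' => h ⟨h'.1, h'.2.1, h'.2.2.1, h'.2.2.2.2⟩
    simp only [h, h1, h2, if_false, add_zero]

/-- **The general single-`d` statement modulo the pocket residual**: on every graph with edges
`d–r` and `d–s`, `dSignSum ≤ 0` as soon as `regionP ≤ 0`. -/
theorem dSignSum_nonpos_of_regionP_nonpos {p q r s d : V} (hr : d ≠ r) (hs : d ≠ s) (hpd : p ≠ d)
    (hqd : q ≠ d) {er es : E} (her : ends er = s(d, r)) (hes : ends es = s(d, s))
    (hP : regionP ends p q r s d ≤ 0) : dSignSum ends p q r s d ≤ 0 := by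
  rw [dSignSum_eq_avoid_sub, dSignSumAvoid_eq_two_regionA p q r s d hpd hqd her hes,
    regionA_eq_add]
  have h1 := regionA1_nonpos hr hs hpd hqd her
  have h2 := eWSum_nonneg_of_edges p q r s d her hes
  have h3 := dzeroSignSumH_nonpos_triple (ends := ends) p q r s d
  linarith

end Region

end NoPocket

end Summit.Ventures.PercRepro2
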